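import Mathlib
import Summits.Ventures.PercRepro.TriangleCapFourBelowPendant
import Summits.Ventures.PercRepro.TriangleCapFourBelowResidueA
import Summits.Ventures.PercRepro.TriangleCapFourBelowResidueD
import Summits.Ventures.PercRepro.TriangleCapThreeBelowDiagonalNine
import Summits.Ventures.PercRepro.TriangleCapFourBelowElevenE

/-!
# PercRepro — THE CELL `(10, 17)`: FOUR BELOW THE DIAGONAL IS EXACT ON THE `K₄⁻`-FREE CLASS FOR EVERY `k ≥ 10`
(p3, gen 40; part 147)

The last open cell of the sub-diagonal `r = 4` closes by a DEGREE ARGUMENT instead of the triangle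
configurations: on `10` vertices with `17` edges the degree sum is `34 = 3·10 + 4`, so
* every degree `≥ 3` forces `Σ_v d(v)² ≤ 16 + 6·34 − 90 = 130` by convexity alone
  (`sum_deg_sq_le_of_min_degree_three`: `Σ (d − 3)² ≤ (Σ (d − 3))² = 16`);
* a vertex of degree `≤ 1` is the deletion of part 131 (`stability_four_of_isolated` / `_of_pendant`);
* a vertex `z` of degree `2` with neighbours `x, y` is deleted onto the cell `(9, 15)` of part 126
  (`dense_stability_three_nine_fifteen`: `Σ_{D−z} d² ≤ 120`), and the deletion identity
  `Σ_D d² = Σ_{D−z} d² + 2 (d(x) + d(y)) + 2` closes with `d(x) + d(y) ≤ 14`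
  (`deg_add_deg_le_fourteen_of_not_adj`): for a NON-ADJACENT pair `x, y` of a `K₄⁻`-free graph on `10` vertices
  with `17` edges, `d(x) + d(y) = |N(x) ∪ N(y)| + |C| ≤ 8 + |C|` with `C` the independent set of common
  neighbours, and `2·17 = 2 (d(x) + d(y)) + Σ_{Sᶜ} degIn Sᶜ` (`S = {x, y}`) — `|C| ≥ 7` leaves at most one
  vertex `w` of `Sᶜ` outside `C`, every edge inside `Sᶜ` is at `w`, and `d(x) + d(y) + degIn C w = 17` forces
  `d(x) + d(y) = 15`, `N(x) ∪ N(y) = Sᶜ ∋ w` and two common neighbours `c ≠ c'` of `w` and `x` (or `y`): a `K₄⁻`.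
  For an adjacent pair `d(x) + d(y) ≤ k + codeg ≤ 11`.

`four_below_diagonal_exact_k4m_ten_seventeen`: the maximum of `2·Σ_v C(d(v), 2)` over the `K₄⁻`-free graphs on
`Fin 10` with `17` edges is `17·8 − 20 = 116`, attained by `K_{3,7}` minus four edges at one vertex — and
**`four_below_diagonal_exact_k4m_all'''`**: the sub-diagonal `r = 4` of the closed form is exact on EVERY cell
`k ≥ 10`, `3 ≤ a`, `2a + 4 ≤ k`.  Axioms: standard.
-/

namespace PercRepro

namespace TriangleCap

namespace C047

open Finset

variable {V : Type*} [Fintype V] [DecidableEq V]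

/-- **THE DEGREE SUM OF A NON-ADJACENT PAIR AT `(10, 17)`:** in a `K₄⁻`-free graph on `10` vertices with `17`
edges, two non-adjacent vertices have `d(x) + d(y) ≤ 14`. -/
theorem deg_add_deg_le_fourteen_of_not_adj (D : SimpleGraph V) [DecidableRel D.Adj] (hK : K4mFree D)
    (hk : Fintype.card V = 10) (hm : D.edgeFinset.card = 17) {x y : V} (hne : x ≠ y) (hxy : ¬ D.Adj x y) :
    deg D x + deg D y ≤ 14 := by
  by_contra hcon
  push Not at hcon
  have hScard : ({x, y} : Finset V).card = 2 := card_pair hne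
  obtain ⟨Nx, hNx⟩ : ∃ Nx : Finset V, Nx = univ.filter (fun v => D.Adj x v) := ⟨_, rfl⟩
  obtain ⟨Ny, hNy⟩ : ∃ Ny : Finset V, Ny = univ.filter (fun v => D.Adj y v) := ⟨_, rfl⟩
  have hdx : deg D x = Nx.card := by rw [hNx]; rfl
  have hdy : deg D y = Ny.card := by rw [hNy]; rfl
  obtain ⟨C, hC⟩ : ∃ C : Finset V, C = Nx ∩ Ny := ⟨_, rfl⟩
  have hUC : (Nx ∪ Ny).card + C.card = Nx.card + Ny.card := by
    rw [hC]; exact card_union_add_card_inter Nx Ny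
  -- the neighbourhoods avoid `x` and `y`
  have hsub : Nx ∪ Ny ⊆ ({x, y} : Finset V)ᶜ := by
    intro v hv
    rw [mem_union, hNx, hNy, mem_filter, mem_filter] at hv
    rw [mem_compl, mem_insert, mem_singleton]
    intro h
    rcases h with h | h
    · rw [h] at hv
      rcases hv with ⟨-, h'⟩ | ⟨-, h'⟩
      · exact D.irrefl h'
      · exact hxy (D.adj_symm h')
    · rw [h] at hv
      rcases hv with ⟨-, h'⟩ | ⟨-, h'⟩
      · exact hxy h'
      · exact D.irrefl h'
  have hScompl : (({x, y} : Finset V)ᶜ).card = 8 := by rw [card_compl, hScard, hk]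
  have hU : (Nx ∪ Ny).card ≤ 8 := by rw [← hScompl]; exact card_le_card hsub
  have hCS : C ⊆ ({x, y} : Finset V)ᶜ := by
    intro c hc
    rw [hC, mem_inter] at hc
    exact hsub (mem_union_left _ hc.1)
  have hC8 : C.card ≤ 8 := by rw [← hScompl]; exact card_le_card hCS
  -- the common neighbours are independent (`K₄⁻`)
  have hCind : ∀ c ∈ C, ∀ c' ∈ C, ¬ D.Adj c c' := by
    intro c hc c' hc' hcc'
    rw [hC, mem_inter, hNx, hNy, mem_filter, mem_filter] at hc hc'
    exact not_adj_both D hK hcc' (D.adj_symm hc.1.2) (D.adj_symm hc'.1.2) hne (D.adj_symm hc.2.2)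
      (D.adj_symm hc'.2.2)
  -- the degree sum through `S = {x, y}`
  have hid := two_mul_card_edges_eq_adjPairs_add D {x, y}
  have hadj0 : adjPairs D ({x, y} : Finset V) = 0 := by
    unfold adjPairs
    rw [card_eq_zero, filter_eq_empty_iff]
    intro p hp
    rw [mem_product, mem_insert, mem_singleton, mem_insert, mem_singleton] at hp
    rcases hp with ⟨h1 | h1, h2 | h2⟩ <;> rw [h1, h2]
    · exact D.irrefl
    · exact hxy
    · exact fun h => hxy (D.adj_symm h)
    · exact D.irrefl
  have hout : ∑ z ∈ ({x, y} : Finset V)ᶜ, degIn D {x, y} z = deg D x + deg D y := by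
    rw [sum_degIn_comm, sum_pair hne]
    have e1 := deg_eq_degIn_add_degIn_compl D {x, y} x
    have e2 := deg_eq_degIn_add_degIn_compl D {x, y} y
    have z1 : degIn D ({x, y} : Finset V) x = 0 := by
      unfold degIn
      rw [card_eq_zero, filter_eq_empty_iff]
      intro v hv
      rw [mem_insert, mem_singleton] at hv
      rcases hv with h | h <;> rw [h]
      · exact D.irrefl
      · exact hxy
    have z2 : degIn D ({x, y} : Finset V) y = 0 := by
      unfold degIn
      rw [card_eq_zero, filter_eq_empty_iff]
      intro v hv
      rw [mem_insert, mem_singleton] at hv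
      rcases hv with h | h <;> rw [h]
      · exact fun h' => hxy (D.adj_symm h')
      · exact D.irrefl
    omega
  rw [hadj0, hout, hm] at hid
  -- the edges inside `Sᶜ` through the independent set `C`
  have hsplit := sum_degIn_compl_split D {x, y} C hCS hCind
  have hT : ((({x, y} : Finset V)ᶜ) \ C).card + C.card = 8 := by
    rw [card_sdiff_of_subset hCS, hScompl]
    omega
  have hC7 : 7 ≤ C.card := by omega
  have hT1 : ((({x, y} : Finset V)ᶜ) \ C).card ≤ 1 := by omega
  have hTT : ∑ w ∈ (({x, y} : Finset V)ᶜ) \ C, degIn D ((({x, y} : Finset V)ᶜ) \ C) w = 0 := by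
    apply sum_eq_zero
    intro w hw
    have := degIn_le_card_sub_one D hw
    omega
  rw [hTT] at hsplit
  rcases eq_empty_or_singleton_of_card_le_one hT1 with hTe | ⟨w, hTw⟩
  · rw [hTe, sum_empty] at hsplit
    omega
  · have hT1' : ((({x, y} : Finset V)ᶜ) \ C).card = 1 := by rw [hTw]; exact card_singleton w
    rw [hTw, sum_singleton] at hsplit
    have hw : w ∈ (({x, y} : Finset V)ᶜ) \ C := by rw [hTw]; exact mem_singleton_self w
    rw [mem_sdiff] at hw
    have hCw : 2 ≤ degIn D C w := by omega
    have hUeq : Nx ∪ Ny = ({x, y} : Finset V)ᶜ := eq_of_subset_of_card_le hsub (by omega)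
    have hwU : w ∈ Nx ∪ Ny := by rw [hUeq]; exact hw.1
    unfold degIn at hCw
    obtain ⟨c, hc, c', hc', hcc'⟩ := one_lt_card.mp hCw
    rw [mem_filter, hC, mem_inter, hNx, hNy, mem_filter, mem_filter] at hc hc'
    rw [mem_union, hNx, hNy, mem_filter, mem_filter] at hwU
    rcases hwU with ⟨-, hxw⟩ | ⟨-, hyw⟩
    · exact not_adj_both D hK hxw hc.1.1.2 hc.2 hcc' hc'.1.1.2 hc'.2
    · exact not_adj_both D hK hyw hc.1.2.2 hc.2 hcc' hc'.1.2.2 hc'.2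

omit [DecidableEq V] in
/-- **EVERY DEGREE `≥ 3` AT `(10, 17)` GIVES `Σ_v d(v)² ≤ 130`:** `Σ (d − 3) = 4` and `Σ (d − 3)² ≤ 16`. -/
theorem sum_deg_sq_le_of_min_degree_three (D : SimpleGraph V) [DecidableRel D.Adj]
    (hk : Fintype.card V = 10) (hm : D.edgeFinset.card = 17) (hdeg : ∀ z, 3 ≤ deg D z) :
    ∑ v, deg D v * deg D v ≤ 130 := by
  have hsum := sum_deg_eq D
  rw [hm] at hsum
  obtain ⟨f, hf⟩ : ∃ f : V → ℕ, ∀ v, deg D v = f v + 3 :=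
    ⟨fun v => deg D v - 3, fun v => (Nat.sub_add_cancel (hdeg v)).symm⟩
  have e1 : ∑ v, deg D v = ∑ v, f v + 3 * Fintype.card V := by
    rw [sum_congr rfl (fun v _ => hf v), sum_add_distrib, sum_const, smul_eq_mul, card_univ]
    ring
  have e2 : ∀ v, deg D v * deg D v = f v * f v + 6 * f v + 9 := fun v => by rw [hf v]; ring
  have e3 : ∑ v, deg D v * deg D v = ∑ v, f v * f v + 6 * ∑ v, f v + 9 * Fintype.card V := by
    rw [sum_congr rfl (fun v _ => e2 v), sum_add_distrib, sum_add_distrib, ← mul_sum, sum_const, smul_eq_mul,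
      card_univ]
    ring
  have hsq := sum_sq_le_sq_sum_nat univ f
  have hf4 : ∑ v, f v = 4 := by omega
  rw [hf4] at hsq
  rw [e3, hf4, hk]
  omega

/-- **A VERTEX OF DEGREE `2` AT `(10, 17)`:** deletion onto the cell `(9, 15)` and `d(x) + d(y) ≤ 14`. -/
theorem stability_four_ten_of_degree_two (D : SimpleGraph V) [DecidableRel D.Adj] (hK : K4mFree D)
    (hk : Fintype.card V = 10) (hm : D.edgeFinset.card = 17) {z : V} (hz : deg D z = 2) :
    ∑ v, deg D v * deg D v + 20 ≤ 170 := by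
  have hz' := hz
  unfold deg at hz'
  obtain ⟨x, y, hxy, hN⟩ := card_eq_two.mp hz'
  have hzx : D.Adj z x := by
    have : x ∈ univ.filter (fun w => D.Adj z w) := by rw [hN]; exact mem_insert_self x {y}
    exact (mem_filter.mp this).2
  have hzy : D.Adj z y := by
    have : y ∈ univ.filter (fun w => D.Adj z w) := by rw [hN]; exact mem_insert_of_mem (mem_singleton_self y)
    exact (mem_filter.mp this).2
  have hnb : ∀ w, D.Adj z w → w = x ∨ w = y := by
    intro w hw
    have : w ∈ univ.filter (fun w => D.Adj z w) := mem_filter.mpr ⟨mem_univ w, hw⟩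
    rw [hN, mem_insert, mem_singleton] at this
    exact this
  have hxz : x ≠ z := hzx.ne.symm
  have hyz : y ≠ z := hzy.ne.symm
  have hcard := card_del z
  have hedges := card_edges_del D z
  rw [hz] at hedges
  have hsq := sum_deg_sq_del D z
  rw [hz] at hsq
  have hsum1 : ∑ a : {v : V // v ≠ z}, (if D.Adj a.1 z then deg (del D z) a else 0) =
      deg (del D z) ⟨x, hxz⟩ + deg (del D z) ⟨y, hyz⟩ := by
    rw [← sum_filter]
    have hfil : univ.filter (fun a : {v : V // v ≠ z} => D.Adj a.1 z) = {⟨x, hxz⟩, ⟨y, hyz⟩} := by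
      ext a
      simp only [mem_filter, mem_univ, true_and, mem_insert, mem_singleton]
      constructor
      · intro h
        rcases hnb a.1 (D.adj_symm h) with h' | h'
        · left; exact Subtype.ext h'
        · right; exact Subtype.ext h'
      · rintro (rfl | rfl)
        · exact D.adj_symm hzx
        · exact D.adj_symm hzy
    rw [hfil, sum_pair]
    intro h
    exact hxy (congrArg Subtype.val h)
  rw [hsum1] at hsq
  have hdx := deg_del D z ⟨x, hxz⟩
  have hdy := deg_del D z ⟨y, hyz⟩
  simp only [D.adj_symm hzx, D.adj_symm hzy, if_true] at hdx hdy
  -- the cell `(9, 15)` on `D − z`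
  have hK' := k4mFree_del D hK z
  have hcard9 : Fintype.card {v : V // v ≠ z} = 9 := by omega
  have hm15 : (del D z).edgeFinset.card = 15 := by omega
  have hnot : ¬ ∃ A : Finset {v : V // v ≠ z}, (∀ x y, (del D z).Adj x y → (x ∈ A ↔ y ∉ A)) ∧
      (missing (del D z) A Aᶜ).card ≤ 2 := by
    rintro ⟨A, hA, hN'⟩
    have hNX := card_missing_add_card_edges (del D z) A hA
    have hXc : Aᶜ.card = 9 - A.card := by
      have := card_add_card_compl A
      rw [hcard9] at this
      omega
    have hXk : A.card ≤ 9 := by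
      have := card_le_univ A
      rwa [hcard9] at this
    rw [hXc, hm15] at hNX
    have hprod : ∀ a', a' ≤ 9 → 15 ≠ a' * (9 - a') ∧ 16 ≠ a' * (9 - a') ∧ 17 ≠ a' * (9 - a') := by decide
    obtain ⟨h1, h2, h3⟩ := hprod A.card hXk
    have : (missing (del D z) A Aᶜ).card = 0 ∨ (missing (del D z) A Aᶜ).card = 1 ∨
        (missing (del D z) A Aᶜ).card = 2 := by omega
    rcases this with h | h | h
    · rw [h] at hNX; exact h1 (by omega)
    · rw [h] at hNX; exact h2 (by omega)
    · rw [h] at hNX; exact h3 (by omega)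
  have h9 := dense_stability_three_nine_fifteen (del D z) hK' hcard9 hm15 hnot
  rw [hcard9, hm15] at h9
  -- `d(x) + d(y) ≤ 14`
  have hxy14 : deg D x + deg D y ≤ 14 := by
    by_cases hadj : D.Adj x y
    · have h1 : deg D x + deg D y + deficit D (x, y) = Fintype.card V + codeg D (x, y) :=
        deg_add_deg_add_deficit D (x, y)
      have h2 : codeg D (x, y) ≤ 1 := codeg_le_one D hK ((mem_adjPairsAll D (x, y)).mpr hadj)
      omega
    · exact deg_add_deg_le_fourteen_of_not_adj D hK hk hm hxy hadj
  omega

/-- **THE `r = 4` STABILITY AT `(10, 17)`:** every `K₄⁻`-free graph on `10` vertices with `17` edges has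
`Σ_v d(v)² + 4 (k − 5) ≤ m k`, i.e. `Σ_v d(v)² ≤ 150`. -/
theorem dense_stability_four_ten_seventeen (D : SimpleGraph V) [DecidableRel D.Adj] (hK : K4mFree D)
    (hk : Fintype.card V = 10) (hm : D.edgeFinset.card = 17) :
    ∑ v, deg D v * deg D v + 4 * (Fintype.card V - 5) ≤ D.edgeFinset.card * Fintype.card V := by
  by_cases hdeg : ∀ z, 3 ≤ deg D z
  · have := sum_deg_sq_le_of_min_degree_three D hk hm hdeg
    rw [hk, hm]
    omega
  push Not at hdeg
  obtain ⟨z, hz⟩ := hdeg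
  have hk10 : 10 ≤ Fintype.card V := by omega
  have hm' : 6 * Fintype.card V ≤ 2 * D.edgeFinset.card + 26 := by omega
  have hprod : ∀ a', a' ≤ Fintype.card V → D.edgeFinset.card ≠ a' * (Fintype.card V - a') ∧
      D.edgeFinset.card + 1 ≠ a' * (Fintype.card V - a') ∧ D.edgeFinset.card + 2 ≠ a' * (Fintype.card V - a') ∧
      D.edgeFinset.card + 3 ≠ a' * (Fintype.card V - a') := by
    rw [hk, hm]
    decide
  rcases (show deg D z = 0 ∨ deg D z = 1 ∨ deg D z = 2 by omega) with h0 | h1 | h2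
  · exact stability_four_of_isolated D hK hk10 hm' hprod h0
  · exact stability_four_of_pendant D hK hk10 hm' hprod h1
  · have := stability_four_ten_of_degree_two D hK hk hm h2
    rw [hk, hm]
    omega

/-- **THE CELL `(10, 17)`:** the maximum of `2·Σ_v C(d(v), 2)` over the `K₄⁻`-free graphs on `Fin 10` with `17`
edges is `17 · 8 − 20 = 116`, attained by `K_{3, 7}` minus four edges at one vertex. -/
theorem four_below_diagonal_exact_k4m_ten_seventeen :
    (∀ (D : SimpleGraph (Fin 10)) [DecidableRel D.Adj], K4mFree D → D.edgeFinset.card = 17 →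
        2 * cherries D + 20 ≤ 136) ∧
      ∃ (D : SimpleGraph (Fin 10)) (_ : DecidableRel D.Adj), K4mFree D ∧
        D.edgeFinset.card = 17 ∧ 2 * cherries D + 20 = 136 := by
  constructor
  · intro D _ hK hD
    have hcard : Fintype.card (Fin 10) = 10 := Fintype.card_fin 10
    have h1 := dense_stability_four_ten_seventeen D hK hcard hD
    have h2 := two_mul_cherries_add D
    have h3 := sum_deg_eq D
    rw [hcard, hD] at h1
    rw [hD] at h3
    omega
  · refine ⟨bipMinusStar 10 3 4, inferInstance, k4mFree_bipMinusStar 10 3 4, ?_, ?_⟩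
    · have := card_edges_bipMinusStar 10 3 4 (by norm_num) (by norm_num)
      omega
    · have h := two_mul_cherries_bipMinusStar 10 3 4 (by norm_num) (by norm_num) (by norm_num)
      norm_num at h
      omega

/-- **FOUR BELOW THE DIAGONAL IS EXACT ON THE `K₄⁻`-FREE CLASS ON EVERY CELL `k ≥ 10`, `3 ≤ a`, `2a + 4 ≤ k`** —
the whole sub-diagonal `r = 4` of the closed form. -/
theorem four_below_diagonal_exact_k4m_all''' (k a : ℕ) (hk : 10 ≤ k) (ha : 3 ≤ a) (hak : 2 * a + 4 ≤ k) :
    (∀ (D : SimpleGraph (Fin k)) [DecidableRel D.Adj], K4mFree D →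
        D.edgeFinset.card = a * (k - a) - 4 →
        2 * cherries D + 4 * (k - 5) ≤ (a * (k - a) - 4) * (k - 2)) ∧
      ∃ (D : SimpleGraph (Fin k)) (_ : DecidableRel D.Adj), K4mFree D ∧
        D.edgeFinset.card = a * (k - a) - 4 ∧ 2 * cherries D + 4 * (k - 5) = (a * (k - a) - 4) * (k - 2) := by
  rcases Nat.lt_or_ge k 11 with h10 | h11
  · have hk10 : k = 10 := by omega
    subst hk10
    have ha3 : a = 3 := by omega
    subst ha3
    have h := four_below_diagonal_exact_k4m_ten_seventeen
    norm_num
    exact h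
  · exact four_below_diagonal_exact_k4m_all'' k a h11 ha hak

end C047

end TriangleCap

end PercRepro
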